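import Summits.QuantumFields.YangMills.Theorems.AlphaInputsT3ACv3LinearLiftMatrixTwistCurl
import Summits.QuantumFields.YangMills.Theorems.AlphaInputsT3ACv3LinearLiftMatrixRegion
import HarnessLib

/-!
# `AlphaInputsT3ACv3LinearLiftMatrixKernel` — (V) THE MATRIX-VALUED PORT OF THE (LL) ENGINE, PART 12: **THE ABSTRACT KERNEL PORT** — every row the Newton shell asks of a lift kernel
# `R` (exactness `Q^{(k)} ∘ R = id`, `𝔰𝔲`-valuedness, sup bound, locality, curl row, CLM packaging `‖T‖·‖R‖`, twisted exactness defect, twisted curl row) stated ONCE for an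
# ARBITRARY linear scalar kernel `T : (PBond P k → ℝ) →ₗ[ℝ] (PBond P 0 → ℝ)` under three scalar hypotheses — (E) `linAvgIter k (T f) = f`, (B) a local sup bound
# `|T f (b)| ≤ ρ·M` from `|f| ≤ M` on a support `N b`, (C) a local curl bound `|curlAt (T f) x μ ν| ≤ ρ′·M` from `|f| ≤ M` on a support `N_c x` — so that ★alpha-2 g6's ONE-BLOCK
# kernel `obLift` (★★OWNER g25 03:01:17Z (r1-ob), kernel-of-record candidate), ★w2 g2's `liftS`, or any truncated∕re-weighted kernel instantiates by `exact` — cell `ym3-torus`,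
# width seat `ym-ust-19936-w3` (g0); def-free

WHY.  ★★OWNER 03:01:48Z: «the MATRIX∕TWIST PORT of `obLift` is ★w3's the moment ★alpha-2's scalar letters land».  Parts 1∕4∕5∕6∕11 did this port for `liftS` by name; THIS FILE
abstracts the kernel so the port of `obLift` (and of ★w4 g2's abstract `R₀`) is instantiation:
* §1 `byEntry_congr_of_bound` ∕ `byEntry_eq_zero_of_bound` (LOCALITY from (B): the port reads the data only on the support `N b`), ★ `linAvgIterM_byEntry_of_exact` ((E) ⇒ matrix
  exactness), `curlM_byEntry_eq` + ★ `norm_curlM_byEntry_le_of_bound` ((C) ⇒ matrix curl row, same constant, no `|n|²`).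
* §2 CLM packaging (`byEntryCLM T ρ`): ★ `avgCLM_byEntryCLM_of_exact` (`T_avg ∘ R = id`), `norm_avgCLM_byEntryCLM_sub_le` (κ = 0), `norm_avgCLM_mul_norm_byEntryCLM_le`
  (`‖T_avg‖·‖R‖ ≤ (d+1)L^k·ρ` — k-uniform when `ρ = C∕L^k`), `norm_curlM_byEntryCLM_le` (`≤ ρ′·‖u‖`), `byEntryCLM_mem`.
* §3 twisted kernel `byEntryTw T ψ`: ★★ `norm_linAvgIterM_byEntryTw_sub_le_of_exact` (exactness defect `(d+1)L^k·ρ·θ·M` for frames θ-close to `1` on the support),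
  `norm_byEntryTw_sub_frozen_le` (frame-variation cost `ρ·θ′·M` at one bond), ★★ `norm_curlM_byEntryTw_le` (the (r1-curl) row: `ρ′·M + 3ρ·θ′·M` for contractive frames frozen to
  within θ′ across the plaquette).
HONEST FRAMING.  Finite-dimensional real linear algebra over the tree's (LL) letters; nothing of [Balaban1985UV3]∕[Balaban1985Variational]∕[Balaban1985Averaging] is asserted;
(FL)∕`hLift`, the stub 2′χ, the crux `HistoryTailL` and any gap are NOT claimed; count-neutral helper (`--supports stmt-QuantumFields-19936`); registry untouched.  YM₃ on the
three-torus is a RUNG of the programme, not the Clay problem; nothing here is about d = 4, infinite volume or a mass gap.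

References: T. Bałaban, Commun. Math. Phys. 109 (1987) 249–301 [Balaban1987RG1] ((0.4), (0.11) p.253); Commun. Math. Phys. 98 (1985) 17–51 [Balaban1985Averaging] ((9), (11)
p.19; Prop. 4 (130)–(131) p.38).
-/

set_option autoImplicit false

noncomputable section

open scoped Matrix.Norms.L2Operator

namespace Summit.QuantumFields.YangMills.Theorems.LinearLiftMatrix

open Finset
open Literature.MathematicalPhysics.QuantumFieldTheory.Balaban1983to89
open Literature.MathematicalPhysics.QuantumFieldTheory.Balaban1985CMP102.Setting
open Summit.QuantumFields.Balaban3D.Carriers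
open Summit.QuantumFields.YangMills.Theorems.AbelianEML (linAvgIter curlAt)

/-! ## §1 Locality, exactness and the curl row of the untwisted port `byEntry T` -/

section Generic

variable {n : Type*} {ι κ : Type*} [Fintype ι] [DecidableEq ι]

/-- **LOCALITY FROM THE SUP BOUND**: a kernel bounded from data on the support `N` only (hypothesis (B)) reads the matrix data only on `N` — two data agreeing there have the same
port at `b`. [folklore] -/
theorem byEntry_congr_of_bound (T : (ι → ℝ) →ₗ[ℝ] (κ → ℝ)) (N : ι → Prop) (b : κ) {C : ℝ} (hT : ∀ (f : ι → ℝ) (M : ℝ), (∀ c, N c → |f c| ≤ M) → |T f b| ≤ C * M)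
    (A A' : ι → Matrix n n ℂ) (h : ∀ c, N c → A c = A' c) : byEntry T A b = byEntry T A' b := by
  rw [byEntry_eq_sum_kernel, byEntry_eq_sum_kernel]
  refine sum_congr rfl fun c _ => ?_
  by_cases hc : N c
  · rw [h c hc]
  · rw [kernel_eq_zero_of_bound T N b hT hc, zero_smul, zero_smul]

/-- **VANISHING OFF THE SUPPORT**: data vanishing on `N` have zero port at `b`. [folklore] -/
theorem byEntry_eq_zero_of_bound (T : (ι → ℝ) →ₗ[ℝ] (κ → ℝ)) (N : ι → Prop) (b : κ) {C : ℝ} (hT : ∀ (f : ι → ℝ) (M : ℝ), (∀ c, N c → |f c| ≤ M) → |T f b| ≤ C * M)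
    (A : ι → Matrix n n ℂ) (h : ∀ c, N c → A c = 0) : byEntry T A b = 0 := by
  rw [byEntry_congr_of_bound T N b hT A (fun _ => 0) h, byEntry_eq_sum_kernel]
  simp

end Generic

section Lattice

variable {P : Params} {n : Type*} (k : ℕ)

/-- **★ (E) ⇒ MATRIX EXACTNESS**: if the scalar kernel is an exact right inverse of the `k`-fold linearised (0.4) average, so is its entrywise port: `linAvgIterM k (byEntry T A) = A`.
[cite: Balaban1987RG1, (0.4)+(0.11) p.253] -/
theorem linAvgIterM_byEntry_of_exact [Fintype n] [DecidableEq n] [Nonempty n] (T : (PBond P k → ℝ) → (PBond P 0 → ℝ)) (hE : ∀ f, linAvgIter k (T f) = f)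
    (A : PBond P k → Matrix n n ℂ) : linAvgIterM k (byEntry T A) = A := by
  rw [linAvgIterM_eq_byEntry, byEntry_comp]
  have h : ((linAvgIter k) ∘ T : (PBond P k → ℝ) → (PBond P k → ℝ)) = id := funext fun f => hE f
  rw [h, byEntry_id]

/-- The matrix curl of the port is the port of the composite `curl ∘ T`. [cite: Balaban1985Averaging, (9) p.19] -/
theorem curlM_byEntry_eq (T : (PBond P k → ℝ) →ₗ[ℝ] (PBond P 0 → ℝ)) (A : PBond P k → Matrix n n ℂ) (x : Site P 0) (μ ν : Fin P.d) :
    curlM (byEntry T A) x μ ν = byEntry ((curlL P 0).comp T) A ⟨x, μ, ν⟩ := by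
  rw [← byEntry_curlL (byEntry T A) ⟨x, μ, ν⟩, byEntry_comp]
  rfl

/-- **★ (C) ⇒ THE MATRIX CURL ROW, SAME CONSTANT**: if `|curlAt (T f) x μ ν| ≤ ρ′·M` whenever `|f c| ≤ M` on the support `N_c`, then `‖curlM (byEntry T A) x μ ν‖ ≤ ρ′·M` whenever
`‖A c‖ ≤ M` on `N_c` (the `ℓ^∞` port of part 1 applied to `curl ∘ T`; no `|n|²`). [cite: Balaban1985Averaging, (9) p.19; Balaban1987RG1, (0.4) p.253] -/
theorem norm_curlM_byEntry_le_of_bound [Fintype n] [DecidableEq n] (T : (PBond P k → ℝ) →ₗ[ℝ] (PBond P 0 → ℝ)) (Nc : PBond P k → Prop) (x : Site P 0) (μ ν : Fin P.d) {ρ' : ℝ}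
    (hC : ∀ (f : PBond P k → ℝ) (M : ℝ), (∀ c, Nc c → |f c| ≤ M) → |curlAt (T f) x μ ν| ≤ ρ' * M)
    (A : PBond P k → Matrix n n ℂ) {M : ℝ} (hM : 0 ≤ M) (hA : ∀ c, Nc c → ‖A c‖ ≤ M) : ‖curlM (byEntry T A) x μ ν‖ ≤ ρ' * M := by
  classical
  rw [curlM_byEntry_eq]
  exact norm_byEntry_le_of_bound ((curlL P 0).comp T) Nc ⟨x, μ, ν⟩ (fun f M' hf => hC f M' hf) A hM hA

/-- `𝔰𝔲`-VALUEDNESS of the port (part 1's `byEntry_mem`, recorded in kernel form). [folklore] -/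
theorem byEntry_mem' (T : (PBond P k → ℝ) →ₗ[ℝ] (PBond P 0 → ℝ)) (S : Submodule ℝ (Matrix n n ℂ)) {A : PBond P k → Matrix n n ℂ} (hA : ∀ c, A c ∈ S) (b : PBond P 0) :
    byEntry T A b ∈ S := by
  classical
  exact byEntry_mem T S hA b

end Lattice

/-! ## §2 CLM packaging: the Newton pair `(T_avg, R) = (avgCLM P k, byEntryCLM T ρ)` -/

section CLM

variable {P : Params} {n : Type*} [Fintype n] [DecidableEq n] (k : ℕ) (T : (PBond P k → ℝ) →ₗ[ℝ] (PBond P 0 → ℝ)) (ρ : ℝ) (hρ : 0 ≤ ρ)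
  (hB : ∀ (f : PBond P k → ℝ) (M : ℝ), (∀ c, |f c| ≤ M) → ∀ b, |T f b| ≤ ρ * M)

/-- **★ `T_avg ∘ R = id`** for the CLM-packaged kernel, from (E). [cite: Balaban1987RG1, (0.4)+(0.11) p.253] -/
theorem avgCLM_byEntryCLM_of_exact [Nonempty n] (hE : ∀ f, linAvgIter k (T f) = f) (u : PBond P k → Matrix n n ℂ) : avgCLM P k (byEntryCLM T ρ hρ hB u) = u := by
  rw [avgCLM_apply, byEntryCLM_apply]
  exact linAvgIterM_byEntry_of_exact k T hE u

/-- ★w4's `hR` with `κ = 0`: `‖T_avg (R u) − u‖ ≤ 0·‖u‖`. [folklore] -/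
theorem norm_avgCLM_byEntryCLM_sub_le [Nonempty n] (hE : ∀ f, linAvgIter k (T f) = f) (u : PBond P k → Matrix n n ℂ) :
    ‖avgCLM P k (byEntryCLM T ρ hρ hB u) - u‖ ≤ 0 * ‖u‖ := by
  rw [avgCLM_byEntryCLM_of_exact k T ρ hρ hB hE, sub_self, norm_zero, zero_mul]

/-- **`‖T_avg‖·‖R‖ ≤ (d+1)·L^k·ρ`** — k-UNIFORM as soon as `ρ = C∕L^k`. [cite: Balaban1987RG1, (0.4)+(0.11) p.253; Balaban1985Averaging, Prop. 4 (130)–(131) p.38] -/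
theorem norm_avgCLM_mul_norm_byEntryCLM_le :
    ‖(avgCLM P k : (PBond P 0 → Matrix n n ℂ) →L[ℝ] (PBond P k → Matrix n n ℂ))‖ *
        ‖(byEntryCLM T ρ hρ hB : (PBond P k → Matrix n n ℂ) →L[ℝ] (PBond P 0 → Matrix n n ℂ))‖ ≤ (((P.d : ℝ) + 1) * (P.L : ℝ) ^ k) * ρ :=
  mul_le_mul (norm_avgCLM_le k) (norm_byEntryCLM_le T ρ hρ hB) (ContinuousLinearMap.opNorm_nonneg _) (by positivity)

/-- The same in the k-uniform shape: `ρ = C∕L^k` ⇒ `‖T_avg‖·‖R‖ ≤ (d+1)·C`. [cite: Balaban1987RG1, (0.4)+(0.11) p.253] -/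
theorem norm_avgCLM_mul_norm_byEntryCLM_le_of_eq {C : ℝ} (hC : ρ = C / (P.L : ℝ) ^ k) :
    ‖(avgCLM P k : (PBond P 0 → Matrix n n ℂ) →L[ℝ] (PBond P k → Matrix n n ℂ))‖ *
        ‖(byEntryCLM T ρ hρ hB : (PBond P k → Matrix n n ℂ) →L[ℝ] (PBond P 0 → Matrix n n ℂ))‖ ≤ ((P.d : ℝ) + 1) * C := by
  have hL : (0 : ℝ) < (P.L : ℝ) ^ k := by have := P.L_pos; positivity
  refine (norm_avgCLM_mul_norm_byEntryCLM_le k T ρ hρ hB).trans (le_of_eq ?_)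
  rw [hC]; field_simp

/-- **THE CURL ROW OF THE PACKAGED KERNEL**: from the GLOBAL scalar curl bound (C) (`|curlAt (T f) x μ ν| ≤ ρ′·M` from `|f| ≤ M`), `‖curlM (R u) x μ ν‖ ≤ ρ′·‖u‖`.
[cite: Balaban1985Averaging, (9) p.19; Balaban1987RG1, (0.4) p.253] -/
theorem norm_curlM_byEntryCLM_le {ρ' : ℝ} (hC : ∀ (f : PBond P k → ℝ) (M : ℝ) (x : Site P 0) (μ ν : Fin P.d), μ ≠ ν → (∀ c, |f c| ≤ M) → |curlAt (T f) x μ ν| ≤ ρ' * M)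
    (u : PBond P k → Matrix n n ℂ) (x : Site P 0) {μ ν : Fin P.d} (hμν : μ ≠ ν) : ‖curlM (byEntryCLM T ρ hρ hB u) x μ ν‖ ≤ ρ' * ‖u‖ := by
  rw [byEntryCLM_apply]
  exact norm_curlM_byEntry_le_of_bound k T (fun _ => True) x μ ν (fun f M hf => hC f M x μ ν hμν fun c => hf c trivial) u (norm_nonneg u) fun c _ => norm_le_pi_norm u c

omit [Fintype n] [DecidableEq n] in
/-- `𝔰𝔲`-valuedness of the packaged kernel. [folklore] -/
theorem byEntryCLM_mem [Fintype n] [DecidableEq n] (S : Submodule ℝ (Matrix n n ℂ)) {u : PBond P k → Matrix n n ℂ} (hu : ∀ c, u c ∈ S) (b : PBond P 0) :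
    byEntryCLM T ρ hρ hB u b ∈ S := by
  classical
  rw [byEntryCLM_apply]; exact byEntry_mem T S hu b

end CLM

/-! ## §3 The twisted kernel `byEntryTw T ψ`: exactness defect, frame variation, the curl row -/

section Twist

open scoped Classical

variable {P : Params} {n : Type*} [Fintype n] [DecidableEq n] (k : ℕ) (T : (PBond P k → ℝ) →ₗ[ℝ] (PBond P 0 → ℝ)) (N : PBond P 0 → PBond P k → Prop) {ρ : ℝ}
  (hB : ∀ (f : PBond P k → ℝ) (M : ℝ) (b : PBond P 0), (∀ c, N b c → |f c| ≤ M) → |T f b| ≤ ρ * M)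
include hB

/-- **★★ THE EXACTNESS DEFECT OF THE TWISTED KERNEL**: for frames `θ`-close to the identity on the support (`‖ψ b c X − X‖ ≤ θ‖X‖`) and data `‖A‖ ≤ M`,
`‖linAvgIterM k (byEntryTw T ψ A) c − A c‖ ≤ ((d+1)L^k)·(ρ·θ·M)` — exactness (E) of the untwisted port, linearity and the sup bound of `Q^{(k)}` applied to the frame-comparison cost;
k-UNIFORM when `ρ = C∕L^k`. [cite: Balaban1987RG1, (0.4)+(0.11) p.253; Balaban1985Averaging, (11) p.19] -/
theorem norm_linAvgIterM_byEntryTw_sub_le_of_exact [Nonempty n] (hE : ∀ f, linAvgIter k (T f) = f) (ψ : PBond P 0 → PBond P k → Matrix n n ℂ →ₗ[ℝ] Matrix n n ℂ) {θ : ℝ}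
    (hθ : 0 ≤ θ) (hψ : ∀ b c X, N b c → ‖ψ b c X - X‖ ≤ θ * ‖X‖) (A : PBond P k → Matrix n n ℂ) {M : ℝ} (hA : ∀ c, ‖A c‖ ≤ M) (c : PBond P k) :
    ‖linAvgIterM k (byEntryTw T ψ A) c - A c‖ ≤ (((P.d : ℝ) + 1) * (P.L : ℝ) ^ k) * (ρ * (θ * M)) := by
  have hM : 0 ≤ M := (norm_nonneg _).trans (hA c)
  have hlin : linAvgIterM k (byEntryTw T ψ A) c - A c = linAvgIterM k (byEntryTw T ψ A - byEntry T A) c := by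
    rw [linAvgIterM_sub, linAvgIterM_byEntry_of_exact k T hE A]
  rw [hlin]
  refine norm_linAvgIterM_le k _ (fun b => ?_) c
  rw [Pi.sub_apply]
  exact norm_byEntryTw_sub_byEntry_le T ψ (N b) b (fun f M' hf => hB f M' b hf) hθ (fun c' hc' X => hψ b c' X hc') A hM fun c' _ => hA c'

/-- **THE FRAME-VARIATION COST AT ONE BOND**: `‖byEntryTw T ψ u b − byEntry T (c ↦ ψ b₁ c (u c)) b‖ ≤ ρ·(θ′·M)` if `‖ψ b c X − ψ b₁ c X‖ ≤ θ′‖X‖` on the support and `‖u‖ ≤ M`.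
[cite: Balaban1987RG1, (0.4)+(0.11) p.253] -/
theorem norm_byEntryTw_sub_frozen_le (ψ : PBond P 0 → PBond P k → Matrix n n ℂ →ₗ[ℝ] Matrix n n ℂ) (u : PBond P k → Matrix n n ℂ) (b b₁ : PBond P 0) {θ' M : ℝ}
    (hθ' : 0 ≤ θ') (hψ : ∀ c X, N b c → ‖ψ b c X - ψ b₁ c X‖ ≤ θ' * ‖X‖) (hu : ∀ c, ‖u c‖ ≤ M) :
    ‖byEntryTw T ψ u b - byEntry T (fun c => ψ b₁ c (u c)) b‖ ≤ ρ * (θ' * M) := by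
  have hM : 0 ≤ M := (norm_nonneg _).trans (hu ⟨fun _ => 0, b.dir⟩)
  rw [← byEntryTw_frozen T (fun c => ψ b₁ c) u b, byEntryTw_sub_frames]
  exact norm_byEntryTw_le_of_frameBound T _ (N b) b (fun f M' hf => hB f M' b hf) hθ' (fun c hc X => by simpa using hψ c X hc) u hM fun c _ => hu c

/-- **★★ THE CURL ROW OF THE TWISTED KERNEL (r1-curl, abstract)**: for CONTRACTIVE frames frozen to within `θ′` between the base bond `b₁ = (x, μ)` and the other three bonds of the
plaquette (on the support), a scalar curl bound (C) `|curlAt (T f) x μ ν| ≤ ρ′·M` (from `|f| ≤ M` on `N_c`), and data `‖u‖ ≤ M`: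
`‖curlM (byEntryTw T ψ u) x μ ν‖ ≤ ρ′·M + 3·ρ·(θ′·M)`. [cite: Balaban1985Averaging, (9)+(11) p.19; Balaban1987RG1, (0.4)+(0.11) p.253] -/
theorem norm_curlM_byEntryTw_le (Nc : PBond P k → Prop) (x : Site P 0) {μ ν : Fin P.d} {ρ' : ℝ}
    (hC : ∀ (f : PBond P k → ℝ) (M : ℝ), (∀ c, Nc c → |f c| ≤ M) → |curlAt (T f) x μ ν| ≤ ρ' * M)
    (ψ : PBond P 0 → PBond P k → Matrix n n ℂ →ₗ[ℝ] Matrix n n ℂ) (hψc : ∀ b c X, ‖ψ b c X‖ ≤ ‖X‖) (u : PBond P k → Matrix n n ℂ) {M : ℝ} (hu : ∀ c, ‖u c‖ ≤ M)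
    {θ' : ℝ} (hθ' : 0 ≤ θ')
    (hψ₂ : ∀ c X, N ⟨x.shift μ, ν⟩ c → ‖ψ ⟨x.shift μ, ν⟩ c X - ψ ⟨x, μ⟩ c X‖ ≤ θ' * ‖X‖)
    (hψ₃ : ∀ c X, N ⟨x.shift ν, μ⟩ c → ‖ψ ⟨x.shift ν, μ⟩ c X - ψ ⟨x, μ⟩ c X‖ ≤ θ' * ‖X‖)
    (hψ₄ : ∀ c X, N ⟨x, ν⟩ c → ‖ψ ⟨x, ν⟩ c X - ψ ⟨x, μ⟩ c X‖ ≤ θ' * ‖X‖) :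
    ‖curlM (byEntryTw T ψ u) x μ ν‖ ≤ ρ' * M + 3 * (ρ * (θ' * M)) := by
  set b₁ : PBond P 0 := ⟨x, μ⟩ with hb₁
  set A' : PBond P k → Matrix n n ℂ := fun c => ψ b₁ c (u c) with hA'
  set Y : PBond P 0 → Matrix n n ℂ := byEntryTw T ψ u with hY
  set Z : PBond P 0 → Matrix n n ℂ := byEntry T A' with hZ
  have hM : 0 ≤ M := (norm_nonneg _).trans (hu ⟨fun _ => 0, μ⟩)
  have hA'M : ∀ c, ‖A' c‖ ≤ M := fun c => (hψc b₁ c (u c)).trans (hu c)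
  have hZcurl : ‖curlM Z x μ ν‖ ≤ ρ' * M := norm_curlM_byEntry_le_of_bound k T Nc x μ ν hC A' hM fun c _ => hA'M c
  have h₁ : Y b₁ - Z b₁ = 0 := by
    have h := norm_byEntryTw_sub_frozen_le k T N hB ψ u b₁ b₁ le_rfl (fun c X _ => by rw [sub_self, norm_zero, zero_mul]) hu
    rw [zero_mul, mul_zero] at h
    exact norm_le_zero_iff.mp h
  have h₂ : ‖Y ⟨x.shift μ, ν⟩ - Z ⟨x.shift μ, ν⟩‖ ≤ ρ * (θ' * M) := norm_byEntryTw_sub_frozen_le k T N hB ψ u _ b₁ hθ' hψ₂ hu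
  have h₃ : ‖Y ⟨x.shift ν, μ⟩ - Z ⟨x.shift ν, μ⟩‖ ≤ ρ * (θ' * M) := norm_byEntryTw_sub_frozen_le k T N hB ψ u _ b₁ hθ' hψ₃ hu
  have h₄ : ‖Y ⟨x, ν⟩ - Z ⟨x, ν⟩‖ ≤ ρ * (θ' * M) := norm_byEntryTw_sub_frozen_le k T N hB ψ u _ b₁ hθ' hψ₄ hu
  have hsplit : curlM Y x μ ν = curlM Z x μ ν + ((Y b₁ - Z b₁) + (Y ⟨x.shift μ, ν⟩ - Z ⟨x.shift μ, ν⟩) - (Y ⟨x.shift ν, μ⟩ - Z ⟨x.shift ν, μ⟩) - (Y ⟨x, ν⟩ - Z ⟨x, ν⟩)) := by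
    simp only [curlM, hb₁]; abel
  rw [hsplit, h₁, zero_add]
  calc ‖curlM Z x μ ν + ((Y ⟨x.shift μ, ν⟩ - Z ⟨x.shift μ, ν⟩) - (Y ⟨x.shift ν, μ⟩ - Z ⟨x.shift ν, μ⟩) - (Y ⟨x, ν⟩ - Z ⟨x, ν⟩))‖
      ≤ ‖curlM Z x μ ν‖ + (‖Y ⟨x.shift μ, ν⟩ - Z ⟨x.shift μ, ν⟩‖ + ‖Y ⟨x.shift ν, μ⟩ - Z ⟨x.shift ν, μ⟩‖ + ‖Y ⟨x, ν⟩ - Z ⟨x, ν⟩‖) := by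
        refine (norm_add_le _ _).trans (add_le_add le_rfl ?_)
        exact (norm_sub_le _ _).trans (add_le_add ((norm_sub_le _ _).trans le_rfl) le_rfl)
    _ ≤ ρ' * M + 3 * (ρ * (θ' * M)) := by linarith

end Twist

end Summit.QuantumFields.YangMills.Theorems.LinearLiftMatrix

end
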